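import Literature.MathematicalPhysics.KineticTheory.DiPernaLionsKernelTruncation
import Literature.Analysis.FluidPDE.CollisionWeakForm
import HarnessLib

/-!
# Null sets under the collision transformation: the gain integral of a.e.-defined densities

Topic: MathematicalPhysics / KineticTheory. Infrastructure for the named fact (L12)
`diPernaLions_limit_expDuhamel` (Cercignani–Illner–Pulvirenti 1994 §5.3 Lemma 5.3.12). The
last step of the supersolution half of the proof of Lemma 5.3.12 (p. 158) is: "Finally, we use
the monotone convergence theorem, the fact that `gₘ ↗ f` in `L¹` and (3.39) to conclude ...
(3.40)". Here `gₘ ↗ f` holds only almost everywhere, while the gain term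
`Q₊(g,g)(v) = ∫∫ B g(v') g(v_*') dω dv_*` evaluates the density at the post-collisional velocities;
that almost-everywhere information in the velocity variable is seen by `Q₊` for almost every `v`
rests on the unit Jacobian of the collision transformation (CIP 1994 §3.1, p. 35;
`Literature.Analysis.FluidPDE.measurePreserving_collideSwap_prod`). This file records the
resulting facts for the true gain integral `eGain`. Everything is proved; theorems only.

* `measure_collide_fst_mem_eq_zero`, `measure_collide_snd_mem_eq_zero`,
  `ae_ae_collide_notMem`: for a Lebesgue-null `N ⊆ E`, for almost every `v`, almost every
  `(v_*, ω)` has `v' ∉ N` and `v_*' ∉ N`.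
* `ae_eGain_congr_of_slice_ae_eq`: densities with a.e.-equal velocity slices have a.e.-equal gain
  integrals.
* `ae_tendsto_eGain_of_monotone` (**monotone convergence for the gain term**): if
  `0 ≤ gₘ(t,x,·) ↗ F(t,x,·)` almost everywhere in the velocity variable and the kernels
  `0 ≤ bₘ ↗ B` pointwise, then `Q₊_{bₘ}(gₘ,gₘ)(t,x,v) → Q₊_B(F,F)(t,x,v)` for almost every `v`.
* `ae_ae_velocity_of_ae_slab`, `ae_slab_of_ae_ae_velocity`: passage between "a.e. on
  `I × E × E`" and "for a.e. `(t, x)`, for a.e. `v`" (the converse for measurable properties).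

## References

* C. Cercignani, R. Illner, M. Pulvirenti, *The Mathematical Theory of Dilute Gases*, Springer
  (1994), §3.1 (p. 35) and §5.3, proof of Lemma 5.3.12 (p. 158).
-/

open MeasureTheory Metric Real Set Filter Topology
open scoped InnerProductSpace ENNReal

noncomputable section

namespace Literature.MathematicalPhysics.KineticTheory

open Literature.Analysis.FluidPDE

variable {E : Type*} [NormedAddCommGroup E] [InnerProductSpace ℝ E] [FiniteDimensional ℝ E]
  [MeasurableSpace E] [BorelSpace E]

/-! ## Null sets under the collision transformation -/

section NullSets

/-- For a null set `N ⊆ E`, the set of `(v, v_*, ω)` with post-collisional velocity `v' ∈ N` is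
null for `dv dv_* dω` (it is the preimage of `E × N × S^{d-1}` under the measure-preserving map
`(v, v_*, ω) ↦ (v_*', v', ω)`). [folklore] -/
theorem measure_collide_fst_mem_eq_zero {N : Set E} (hNm : MeasurableSet N)
    (hN : volume N = 0) :
    (((volume : Measure E).prod volume).prod sphereMeasure)
      {q : (E × E) × sphere (0 : E) 1 | (collide q.2 q.1).1 ∈ N} = 0 := by
  haveI := isFiniteMeasure_sphereMeasure (E := E)
  have hpre : {q : (E × E) × sphere (0 : E) 1 | (collide q.2 q.1).1 ∈ N} =
      (fun q : (E × E) × sphere (0 : E) 1 => ((collide q.2 q.1).swap, q.2)) ⁻¹'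
        (((univ : Set E) ×ˢ N) ×ˢ (univ : Set (sphere (0 : E) 1))) := by
    ext q; simp
  have hmeas : MeasurableSet (((univ : Set E) ×ˢ N) ×ˢ (univ : Set (sphere (0 : E) 1))) :=
    (MeasurableSet.univ.prod hNm).prod MeasurableSet.univ
  rw [hpre, (measurePreserving_collideSwap_prod (E := E)).measure_preimage hmeas.nullMeasurableSet,
    Measure.prod_prod, Measure.prod_prod, hN, mul_zero, zero_mul]

/-- For a null set `N ⊆ E`, the set of `(v, v_*, ω)` with `v_*' ∈ N` is null for `dv dv_* dω`.
[folklore] -/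
theorem measure_collide_snd_mem_eq_zero {N : Set E} (hNm : MeasurableSet N)
    (hN : volume N = 0) :
    (((volume : Measure E).prod volume).prod sphereMeasure)
      {q : (E × E) × sphere (0 : E) 1 | (collide q.2 q.1).2 ∈ N} = 0 := by
  haveI := isFiniteMeasure_sphereMeasure (E := E)
  have hpre : {q : (E × E) × sphere (0 : E) 1 | (collide q.2 q.1).2 ∈ N} =
      (fun q : (E × E) × sphere (0 : E) 1 => ((collide q.2 q.1).swap, q.2)) ⁻¹'
        ((N ×ˢ (univ : Set E)) ×ˢ (univ : Set (sphere (0 : E) 1))) := by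
    ext q; simp
  have hmeas : MeasurableSet ((N ×ˢ (univ : Set E)) ×ˢ (univ : Set (sphere (0 : E) 1))) :=
    (hNm.prod MeasurableSet.univ).prod MeasurableSet.univ
  rw [hpre, (measurePreserving_collideSwap_prod (E := E)).measure_preimage hmeas.nullMeasurableSet,
    Measure.prod_prod, Measure.prod_prod, hN, zero_mul, zero_mul]

/-- **Post-collisional velocities avoid null sets**: for a Lebesgue-null `N ⊆ E`, for almost every
`v`, almost every `(v_*, ω)` (for `dv_* dω`) has `v' ∉ N` and `v_*' ∉ N`. [folklore] -/
theorem ae_ae_collide_notMem {N : Set E} (hN : volume N = 0) :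
    ∀ᵐ v : E ∂volume, ∀ᵐ q : E × sphere (0 : E) 1 ∂(volume.prod sphereMeasure),
      (collide q.2 (v, q.1)).1 ∉ N ∧ (collide q.2 (v, q.1)).2 ∉ N := by
  haveI := isFiniteMeasure_sphereMeasure (E := E)
  obtain ⟨N', hNN', hN'm, hN'⟩ := exists_measurable_superset_of_null hN
  -- the bad set is null for `((dv dv_*) dω)`
  have hbad : ∀ᵐ q : (E × E) × sphere (0 : E) 1 ∂(((volume : Measure E).prod volume).prod sphereMeasure),
      (collide q.2 q.1).1 ∉ N' ∧ (collide q.2 q.1).2 ∉ N' := by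
    have h1 := measure_eq_zero_iff_ae_notMem.1 (measure_collide_fst_mem_eq_zero hN'm hN')
    have h2 := measure_eq_zero_iff_ae_notMem.1 (measure_collide_snd_mem_eq_zero hN'm hN')
    filter_upwards [h1, h2] with q hq1 hq2
    exact ⟨hq1, hq2⟩
  -- regroup `((v, v_*), ω) ↦ (v, (v_*, ω))`
  have hmp := (measurePreserving_prodAssoc (volume : Measure E) (volume : Measure E)
    (sphereMeasure : Measure (sphere (0 : E) 1))).symm
  have hbad' := hmp.quasiMeasurePreserving.ae hbad
  have hbad'' : ∀ᵐ p : E × (E × sphere (0 : E) 1) ∂((volume : Measure E).prod (volume.prod sphereMeasure)),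
      (collide p.2.2 (p.1, p.2.1)).1 ∉ N ∧ (collide p.2.2 (p.1, p.2.1)).2 ∉ N := by
    filter_upwards [hbad'] with p hp
    exact ⟨fun h => hp.1 (hNN' h), fun h => hp.2 (hNN' h)⟩
  exact Measure.ae_ae_of_ae_prod hbad''

end NullSets

/-! ## The gain integral of a.e.-defined densities -/

section Gain

variable {B : E × E → sphere (0 : E) 1 → ℝ}

/-- **Densities with a.e.-equal velocity slices have a.e.-equal gain integrals**: if
`f₁(t,x,·) = f₂(t,x,·)` a.e. on `E`, then `Q₊(f₁,f₁)(t,x,v) = Q₊(f₂,f₂)(t,x,v)` (true gain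
integrals, any kernel) for almost every `v`. [folklore] -/
theorem ae_eGain_congr_of_slice_ae_eq {f₁ f₂ : ℝ → E → E → ℝ} {t : ℝ} {x : E}
    (h : (fun u => f₁ t x u) =ᵐ[volume] fun u => f₂ t x u) :
    ∀ᵐ v : E ∂volume, eGain B f₁ (t, x, v) = eGain B f₂ (t, x, v) := by
  have hN : volume {u : E | f₁ t x u ≠ f₂ t x u} = 0 := by
    have := h; rw [Filter.EventuallyEq, ae_iff] at this; simpa using this
  filter_upwards [ae_ae_collide_notMem hN] with v hv
  unfold eGain
  refine lintegral_congr_ae (hv.mono fun q hq => ?_)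
  simp only [not_not] at hq
  dsimp only
  rw [hq.1, hq.2]

/-- **Monotone convergence for the gain term.** Let `bₘ, B` be kernels with `0 ≤ bₘ ↗ B`
pointwise (`bₘ` nondecreasing in `m`, converging to `B`), and let `gₘ, F` be densities such that,
for almost every velocity `u`, `0 ≤ gₘ(t,x,u)` is nondecreasing in `m` and converges to
`F(t,x,u)`. Then for almost every `v`,
`Q₊_{bₘ}(gₘ,gₘ)(t,x,v) → Q₊_B(F,F)(t,x,v)` in `[0, ∞]` (true gain integrals; the measurability
assumptions make the integrands a.e.-measurable). [folklore] -/
theorem ae_tendsto_eGain_of_monotone {b : ℕ → E × E → sphere (0 : E) 1 → ℝ}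
    (hbm : ∀ m, Measurable (Function.uncurry (b m))) (hb0 : ∀ m p ω, 0 ≤ b m p ω)
    (hbmono : ∀ p ω, Monotone fun m => b m p ω)
    (hblim : ∀ p ω, Tendsto (fun m => b m p ω) atTop (𝓝 (B p ω)))
    {g : ℕ → ℝ → E → E → ℝ} {F : ℝ → E → E → ℝ}
    (hgm : ∀ m, Measurable fun z : ℝ × E × E => g m z.1 z.2.1 z.2.2) {t : ℝ} {x : E}
    (hg0 : ∀ m, ∀ᵐ u : E ∂volume, 0 ≤ g m t x u)
    (hgmono : ∀ᵐ u : E ∂volume, Monotone fun m => g m t x u)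
    (hglim : ∀ᵐ u : E ∂volume, Tendsto (fun m => g m t x u) atTop (𝓝 (F t x u))) :
    ∀ᵐ v : E ∂volume, Tendsto (fun m => eGain (b m) (g m) (t, x, v)) atTop
      (𝓝 (eGain B F (t, x, v))) := by
  haveI := isFiniteMeasure_sphereMeasure (E := E)
  -- the good velocity set
  have hg0' : ∀ᵐ u : E ∂volume, ∀ m, 0 ≤ g m t x u := ae_all_iff.2 hg0
  have hN : volume {u : E | ¬ ((∀ m, 0 ≤ g m t x u) ∧ Monotone (fun m => g m t x u) ∧
      Tendsto (fun m => g m t x u) atTop (𝓝 (F t x u)))} = 0 := by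
    have : ∀ᵐ u : E ∂volume, (∀ m, 0 ≤ g m t x u) ∧ Monotone (fun m => g m t x u) ∧
        Tendsto (fun m => g m t x u) atTop (𝓝 (F t x u)) := by
      filter_upwards [hg0', hgmono, hglim] with u h1 h2 h3
      exact ⟨h1, h2, h3⟩
    exact ae_iff.1 this
  filter_upwards [ae_ae_collide_notMem hN] with v hv
  unfold eGain
  refine lintegral_tendsto_of_tendsto_of_monotone (fun m => ?_) ?_ ?_
  · exact ((measurable_gainIntegrand_param (hbm m) (hgm m)).comp
      (measurable_prodMk_left (x := ((t, x, v) : ℝ × E × E)))).ennreal_ofReal.aemeasurable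
  · filter_upwards [hv] with q hq
    simp only [not_not] at hq
    obtain ⟨⟨h01, hm1, -⟩, ⟨h02, hm2, -⟩⟩ := hq
    intro m m' hmm'
    refine ENNReal.ofReal_le_ofReal (mul_le_mul (hbmono _ _ hmm') ?_ ?_ (hb0 _ _ _))
    · exact mul_le_mul (hm1 hmm') (hm2 hmm') (h02 m) ((h01 m).trans (hm1 hmm'))
    · exact mul_nonneg (h01 m) (h02 m)
  · filter_upwards [hv] with q hq
    simp only [not_not] at hq
    obtain ⟨⟨-, -, hl1⟩, ⟨-, -, hl2⟩⟩ := hq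
    exact (ENNReal.continuous_ofReal.tendsto _).comp ((hblim _ _).mul (hl1.mul hl2))

/-- **Monotone convergence for the gain term, supremum form**: under the hypotheses of
`ae_tendsto_eGain_of_monotone`, for almost every `v` the sequence `Q₊_{bₘ}(gₘ,gₘ)(t,x,v)` is
nondecreasing with supremum `Q₊_B(F,F)(t,x,v)`. [folklore] -/
theorem ae_iSup_eGain_of_monotone {b : ℕ → E × E → sphere (0 : E) 1 → ℝ}
    (hbm : ∀ m, Measurable (Function.uncurry (b m))) (hb0 : ∀ m p ω, 0 ≤ b m p ω)
    (hbmono : ∀ p ω, Monotone fun m => b m p ω)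
    (hblim : ∀ p ω, Tendsto (fun m => b m p ω) atTop (𝓝 (B p ω)))
    {g : ℕ → ℝ → E → E → ℝ} {F : ℝ → E → E → ℝ}
    (hgm : ∀ m, Measurable fun z : ℝ × E × E => g m z.1 z.2.1 z.2.2) {t : ℝ} {x : E}
    (hg0 : ∀ m, ∀ᵐ u : E ∂volume, 0 ≤ g m t x u)
    (hgmono : ∀ᵐ u : E ∂volume, Monotone fun m => g m t x u)
    (hglim : ∀ᵐ u : E ∂volume, Tendsto (fun m => g m t x u) atTop (𝓝 (F t x u))) :
    ∀ᵐ v : E ∂volume, (Monotone fun m => eGain (b m) (g m) (t, x, v)) ∧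
      (⨆ m, eGain (b m) (g m) (t, x, v)) = eGain B F (t, x, v) := by
  have hg0' : ∀ᵐ u : E ∂volume, ∀ m, 0 ≤ g m t x u := ae_all_iff.2 hg0
  have hN : volume {u : E | ¬ ((∀ m, 0 ≤ g m t x u) ∧ Monotone (fun m => g m t x u))} = 0 := by
    have : ∀ᵐ u : E ∂volume, (∀ m, 0 ≤ g m t x u) ∧ Monotone (fun m => g m t x u) := by
      filter_upwards [hg0', hgmono] with u h1 h2
      exact ⟨h1, h2⟩
    exact ae_iff.1 this
  filter_upwards [ae_tendsto_eGain_of_monotone hbm hb0 hbmono hblim hgm hg0 hgmono hglim,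
    ae_ae_collide_notMem hN] with v hv hv'
  have hmono : Monotone fun m => eGain (b m) (g m) (t, x, v) := by
    intro m m' hmm'
    unfold eGain
    refine lintegral_mono_ae (hv'.mono fun q hq => ?_)
    simp only [not_not] at hq
    obtain ⟨⟨h01, hm1⟩, ⟨h02, hm2⟩⟩ := hq
    refine ENNReal.ofReal_le_ofReal (mul_le_mul (hbmono _ _ hmm') ?_ ?_ (hb0 _ _ _))
    · exact mul_le_mul (hm1 hmm') (hm2 hmm') (h02 m) ((h01 m).trans (hm1 hmm'))
    · exact mul_nonneg (h01 m) (h02 m)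
  exact ⟨hmono, tendsto_nhds_unique (tendsto_atTop_iSup hmono) hv⟩

end Gain

/-! ## Slab statements and velocity slices -/

section Slices

/-- Lebesgue measure on `I × E × E` as the product of Lebesgue measure on `I × E` and on `E`,
through the regrouping `(t, (x, v)) ↦ ((t, x), v)`. [folklore] -/
theorem measurePreserving_prodAssoc_symm_slab (I : Set ℝ) :
    MeasurePreserving (MeasurableEquiv.prodAssoc.symm : ℝ × E × E ≃ᵐ (ℝ × E) × E)
      ((volume : Measure (ℝ × E × E)).restrict (I ×ˢ univ))
      (((volume : Measure (ℝ × E)).restrict (I ×ˢ univ)).prod (volume : Measure E)) := by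
  have h1 : (volume : Measure (ℝ × E × E)).restrict (I ×ˢ univ) =
      ((volume : Measure ℝ).restrict I).prod ((volume : Measure E).prod (volume : Measure E)) := by
    rw [show (volume : Measure (ℝ × E × E)) = (volume : Measure ℝ).prod ((volume : Measure E).prod volume)
      from rfl, ← Measure.restrict_univ (μ := ((volume : Measure E).prod (volume : Measure E))),
      Measure.prod_restrict, Measure.restrict_univ]
  have h3 : (volume : Measure (ℝ × E)).restrict (I ×ˢ univ) =
      ((volume : Measure ℝ).restrict I).prod (volume : Measure E) := by
    rw [show (volume : Measure (ℝ × E)) = (volume : Measure ℝ).prod (volume : Measure E) from rfl,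
      ← Measure.restrict_univ (μ := (volume : Measure E)), Measure.prod_restrict, Measure.restrict_univ]
  rw [h1, h3]
  exact (measurePreserving_prodAssoc ((volume : Measure ℝ).restrict I) (volume : Measure E)
    (volume : Measure E)).symm _

/-- **From "a.e. on the slab" to "for a.e. `(t,x)`, for a.e. `v`".** [folklore] -/
theorem ae_ae_velocity_of_ae_slab {I : Set ℝ} {p : ℝ × E × E → Prop}
    (h : ∀ᵐ z ∂((volume : Measure (ℝ × E × E)).restrict (I ×ˢ univ)), p z) :
    ∀ᵐ q : ℝ × E ∂((volume : Measure (ℝ × E)).restrict (I ×ˢ univ)), ∀ᵐ v : E ∂volume,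
      p (q.1, q.2, v) := by
  have hmp := measurePreserving_prodAssoc_symm_slab (E := E) I
  have h' := (hmp.symm _).quasiMeasurePreserving.ae h
  exact Measure.ae_ae_of_ae_prod h'

/-- **From "for a.e. `(t,x)`, for a.e. `v`" to "a.e. on the slab"**, for a measurable property.
[folklore] -/
theorem ae_slab_of_ae_ae_velocity {I : Set ℝ} {p : ℝ × E × E → Prop}
    (hp : MeasurableSet {z : ℝ × E × E | p z})
    (h : ∀ᵐ q : ℝ × E ∂((volume : Measure (ℝ × E)).restrict (I ×ˢ univ)), ∀ᵐ v : E ∂volume,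
      p (q.1, q.2, v)) :
    ∀ᵐ z ∂((volume : Measure (ℝ × E × E)).restrict (I ×ˢ univ)), p z := by
  have hmp := measurePreserving_prodAssoc_symm_slab (E := E) I
  have hp' : MeasurableSet {w : (ℝ × E) × E | p (w.1.1, w.1.2, w.2)} :=
    hp.preimage (MeasurableEquiv.prodAssoc : (ℝ × E) × E ≃ᵐ ℝ × E × E).measurable
  have h' : ∀ᵐ w : (ℝ × E) × E ∂(((volume : Measure (ℝ × E)).restrict (I ×ˢ univ)).prod (volume : Measure E)),
      p (w.1.1, w.1.2, w.2) :=
    (Measure.ae_prod_iff_ae_ae hp').2 h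
  have h'' := hmp.quasiMeasurePreserving.ae h'
  exact h''.mono fun z hz => by
    simpa [MeasurableEquiv.prodAssoc, Equiv.prodAssoc] using hz

end Slices

end Literature.MathematicalPhysics.KineticTheory
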